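import Summits.Ventures.LatticeQCDFlow.Exactness.IMHSignObservableSandwich
import Summits.Ventures.LatticeQCDFlow.Exactness.Phi4LeapfrogPerm
import Mathlib.MeasureTheory.Measure.Lebesgue.EqHaar
import HarnessLib

/-!
# The sign of the magnetisation under the φ⁴ flow sampler: `¼(1/q̃(M ≥ 0) + 1/q̃(M < 0)) − ½ ≤ 1/κ − ½ ≤ τ_int(sign M)` for EVERY model

HONEST FRAMING: exact (Metropolis-corrected) sampling algorithms for lattice gauge theory;
figures of merit are autocorrelation/cost numbers at stated couplings and volumes; no
continuum-physics claim.  (SCALAR calibration rung S0-A: not a gauge result.)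

Venture `LatticeQCDFlow` (cell pub-lqcd), topic `Exactness`; FANOUT row 2 (`s0-phi4`, FLOW arm: the
tunnelling observable of the 2D φ⁴ calibration in its broken phase).  NEW WORK of the cell over row
2's `IMHSignObservableSandwich` (`1/κ − ½ ≤ τ_int ≤ ½ + 12/κ` for every BALANCED SIGN observable,
`κ = Z²/W₂` the Kish ESS fraction), Mathlib's negation invariance of Lebesgue measure and the null
hyperplane `{Σφ = 0}`.  Nothing is cited as a fact.  Printed counterparts, NAMED ONLY: the
mode-collapse barrier of flow samplers (Kanwar et al. 2020, Hackett et al. 2021, Nicoli et al. 2021);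
this tree's `Scoring/FlowSamplerSectorFloor` (row 8: `(1 − π(A))/q(Aᶜ) − ½` under a Doeblin constant).

Setting: lattice φ⁴ on `V = n + 1` sites, `S = Σ φJφ + λΣφ⁴`, `λ > 0`, any real `J` (the action is
EVEN: `S(−φ) = S(φ)`); the exact flow sampler `imhOpPhi4 J λ q̃` with ANY positive measurable model
density `q̃`, `∫ q̃ = 1`, square-integrable weights `W₂ = ∫ e^{−2S}/q̃ < ∞`; `Z = ∫ e^{−S}`;
`sgn M(φ) = 1` if `Σ_x φ_x ≥ 0`, `−1` else; `q̃₊ = ∫_{M ≥ 0} q̃`, `q̃₋ = ∫_{M < 0} q̃` the model's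
sector masses.

## What is proved

* `latticePhi4Action_neg`, `gibbsWeight_neg` — `Z₂` symmetry of the target; `volume_sumZero` — the
  hyperplane `{Σφ = 0}` is Lebesgue-null (a strict submodule); **`gibbs_signM_mean`** — `⟨sgn M⟩ = 0`:
  the sign of the magnetisation IS a balanced sign observable (negation invariance of Lebesgue measure,
  `Phi4LeapfrogPerm.isNegInvariant_volume_pi`, + the null hyperplane), and
  `integral_posSector_mul_gibbsWeight` — `π(M ≥ 0) = ½`.
* **`phi4Flow_signM_tauInt_sandwich`** — for EVERY model: `W₂/Z² − ½ ≤ τ_int(sgn M) ≤ ½ + 12 W₂/Z²`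
  — the tunnelling time of the flow arm IS the inverse ESS fraction up to `(1, 12)` and `½`.
* `sq_integral_le_integral_mul` — Cauchy–Schwarz `(∫ m g)² ≤ (∫ m)(∫ m g²)` for `m ≥ 0` WITHOUT
  boundedness of `g`; `weightMoment_ge_sectors` — two-sector data processing for `χ²`:
  `W₂ ≥ (Z²/4)(1/q̃₊ + 1/q̃₋)` (each sector carries target mass `Z/2`).
* **`phi4Flow_signM_tauInt_ge_sectors`** — THE MODE-COLLAPSE FLOOR OF THE φ⁴ FLOW ARM:
  `τ_int(sgn M) ≥ ¼(1/q̃₊ + 1/q̃₋) − ½` for every model with square-integrable weights: a flow that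
  proposes one magnetisation sector with probability `ε` forces `τ_int(sgn M) ≥ 1/(4ε(1 − ε)) − ½`
  — at every volume, whatever the acceptance, with NO mixing hypothesis (if `W₂ = ∞` some bounded
  observable is not even summable: `IMHTauIntInfiniteOfWeightMoment`).

Reading for S0-A (no numerics implied): in the broken phase the tunnelling observable `sgn M` of the
flow arm costs at least `1/κ − ½` steps per independent sign, and at least `1/(4ε) − ½` if the trained
flow under-covers one sector to mass `ε`; both are leaderboard columns (ESS fraction; sector occupancy
of the model draws).  NOT CLAIMED: any value of `κ` or `ε` for a trained network; `λ = 0`; HMC / local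
arms; the sharper constant `1/(2ε)` of row 8's Doeblin-conditional sector floor.
-/

namespace Summit.Ventures.LatticeQCDFlow.Exactness

open Real MeasureTheory Filter Finset
open Summit.Ventures.LatticeQCDFlow.Scoring

/-! ## §1 Cauchy–Schwarz without boundedness -/
section CS

variable {X : Type*} [MeasurableSpace X] {μ : Measure X}

/-- **`(∫ m g)² ≤ (∫ m)(∫ m g²)`** for `m ≥ 0`, `m`, `m g`, `m g²` integrable (no bound on `g`). -/
theorem sq_integral_le_integral_mul {m g : X → ℝ} (hm0 : ∀ t, 0 ≤ m t) (hmi : Integrable m μ)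
    (hmg : Integrable (fun t => m t * g t) μ) (hmg2 : Integrable (fun t => m t * g t ^ 2) μ) :
    (∫ t, m t * g t ∂μ) ^ 2 ≤ (∫ t, m t ∂μ) * ∫ t, m t * g t ^ 2 ∂μ := by
  set M := ∫ t, m t ∂μ with hM
  set P := ∫ t, m t * g t ∂μ with hP
  set Q := ∫ t, m t * g t ^ 2 ∂μ with hQ
  have hM0 : 0 ≤ M := integral_nonneg hm0
  have hQ0 : 0 ≤ Q := integral_nonneg fun t => mul_nonneg (hm0 t) (sq_nonneg _)
  -- `0 ≤ ∫ m (g − s)² = Q − 2 s P + s² M` for every real `s`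
  have hquad : ∀ s : ℝ, 0 ≤ Q - 2 * s * P + s ^ 2 * M := by
    intro s
    have hI : Integrable (fun t => m t * (g t - s) ^ 2) μ := by
      refine ((hmg2.sub (hmg.const_mul (2 * s))).add (hmi.const_mul (s ^ 2))).congr
        (Eventually.of_forall fun t => ?_)
      simp only [Pi.add_apply, Pi.sub_apply]
      ring
    have h0 : 0 ≤ ∫ t, m t * (g t - s) ^ 2 ∂μ := integral_nonneg fun t => mul_nonneg (hm0 t) (sq_nonneg _)
    have e : ∫ t, m t * (g t - s) ^ 2 ∂μ = Q - 2 * s * P + s ^ 2 * M := by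
      have e1 : (fun t => m t * (g t - s) ^ 2)
          = fun t => (m t * g t ^ 2 - 2 * s * (m t * g t)) + s ^ 2 * m t := funext fun t => by ring
      have h12 : Integrable (fun t => m t * g t ^ 2 - 2 * s * (m t * g t)) μ :=
        hmg2.sub (hmg.const_mul _)
      have h3 : Integrable (fun t => s ^ 2 * m t) μ := hmi.const_mul _
      have h2 : Integrable (fun t => 2 * s * (m t * g t)) μ := hmg.const_mul _
      rw [e1, integral_add h12 h3, integral_sub hmg2 h2, integral_const_mul, integral_const_mul]
    rw [e] at h0
    exact h0
  rcases hM0.lt_or_eq with hMpos | hMz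
  · have h := hquad (P / M)
    have e : Q - 2 * (P / M) * P + (P / M) ^ 2 * M = Q - P ^ 2 / M := by
      field_simp
      ring
    rw [e] at h
    have : P ^ 2 / M ≤ Q := by linarith
    rwa [div_le_iff₀ hMpos, mul_comm] at this
  · -- `∫ m = 0`: the quadratic `Q − 2 s P ≥ 0` for all `s` forces `P = 0`
    have hP0 : P = 0 := by
      by_contra hne
      have h := hquad ((Q + 1) / (2 * P))
      rw [← hMz, mul_zero, add_zero] at h
      have e : 2 * ((Q + 1) / (2 * P)) * P = Q + 1 := by field_simp
      rw [e] at h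
      linarith
    rw [hP0, ← hMz]
    simp only [ne_eq, OfNat.ofNat_ne_zero, not_false_eq_true, zero_pow, zero_mul, le_refl]

end CS

/-! ## §2 `Z₂` symmetry: the sign of the magnetisation is balanced -/
section Lattice

variable {n : ℕ}

/-- The φ⁴ action is even: `S(−φ) = S(φ)`. -/
theorem latticePhi4Action_neg (J : Fin (n + 1) → Fin (n + 1) → ℝ) (lam : ℝ) (φ : Fin (n + 1) → ℝ) :
    latticePhi4Action J lam (-φ) = latticePhi4Action J lam φ := by
  unfold latticePhi4Action
  simp only [Pi.neg_apply]
  congr 1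
  · exact Finset.sum_congr rfl fun x _ => Finset.sum_congr rfl fun y _ => by ring
  · congr 1
    exact Finset.sum_congr rfl fun x _ => by ring

/-- The Gibbs weight is even: `e^{−S(−φ)} = e^{−S(φ)}`. -/
theorem gibbsWeight_neg (J : Fin (n + 1) → Fin (n + 1) → ℝ) (lam : ℝ) (φ : Fin (n + 1) → ℝ) :
    gibbsWeight J lam (-φ) = gibbsWeight J lam φ := by
  unfold gibbsWeight
  rw [latticePhi4Action_neg]

/-- **The hyperplane `{Σ_x φ_x = 0}` is Lebesgue-null** (a strict linear subspace of `ℝ^{n+1}`). -/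
theorem volume_sumZero : (volume : Measure (Fin (n + 1) → ℝ)) {φ | ∑ x, φ x = 0} = 0 := by
  set L : (Fin (n + 1) → ℝ) →ₗ[ℝ] ℝ := ∑ x : Fin (n + 1), LinearMap.proj x with hL
  have hLapp : ∀ φ : Fin (n + 1) → ℝ, L φ = ∑ x, φ x := fun φ => by
    rw [hL, LinearMap.sum_apply]
    rfl
  have hker : {φ : Fin (n + 1) → ℝ | ∑ x, φ x = 0} = (LinearMap.ker L : Set (Fin (n + 1) → ℝ)) := by
    ext φ
    simp only [Set.mem_setOf_eq, SetLike.mem_coe, LinearMap.mem_ker, hLapp]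
  have hne : LinearMap.ker L ≠ ⊤ := by
    intro htop
    have hmem : (fun _ : Fin (n + 1) => (1 : ℝ)) ∈ LinearMap.ker L := htop ▸ Submodule.mem_top
    rw [LinearMap.mem_ker, hLapp] at hmem
    simp only [Finset.sum_const, Finset.card_univ, Fintype.card_fin, nsmul_eq_mul, mul_one] at hmem
    have : (0 : ℝ) < (n : ℝ) + 1 := by positivity
    push_cast at hmem
    linarith
  rw [hker]
  exact Measure.addHaar_submodule volume (LinearMap.ker L) hne

/-- **`⟨sgn M⟩ = 0`: the sign of the magnetisation is a BALANCED sign observable of lattice φ⁴**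
(every `λ`, `J`: `∫ sgn M · e^{−S} = 0` by `φ ↦ −φ`; the hyperplane `M = 0` is null). -/
theorem integral_signM_mul_gibbsWeight (J : Fin (n + 1) → Fin (n + 1) → ℝ) (lam : ℝ) :
    ∫ φ : Fin (n + 1) → ℝ, (if 0 ≤ ∑ x, φ x then (1 : ℝ) else -1) * gibbsWeight J lam φ = 0 := by
  haveI := isNegInvariant_volume_pi (Λ := Fin (n + 1))
  set h : (Fin (n + 1) → ℝ) → ℝ := fun φ => (if 0 ≤ ∑ x, φ x then (1 : ℝ) else -1) * gibbsWeight J lam φ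
    with hh
  have hrefl := integral_neg_eq_self h volume
  have hae : (fun φ => h (-φ)) =ᵐ[volume] fun φ => -h φ := by
    filter_upwards [measure_eq_zero_iff_ae_notMem.mp (volume_sumZero (n := n))] with φ hφ
    have hφ0 : ∑ x, φ x ≠ 0 := fun e => hφ (by simpa using e)
    have hneg : ∑ x, (-φ) x = -∑ x, φ x := by simp only [Pi.neg_apply, Finset.sum_neg_distrib]
    simp only [hh, hneg, gibbsWeight_neg, neg_nonneg]
    rcases lt_or_gt_of_ne hφ0 with hlt | hgt
    · rw [if_pos hlt.le, if_neg (not_le.mpr hlt)]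
      ring
    · rw [if_neg (not_le.mpr hgt), if_pos hgt.le]
      ring
  rw [integral_congr_ae hae, integral_neg] at hrefl
  have : ∫ φ, h φ = 0 := by linarith
  simpa [hh] using this

/-- `⟨sgn M⟩ = 0` in the Gibbs-expectation vocabulary. -/
theorem gibbs_signM_mean (J : Fin (n + 1) → Fin (n + 1) → ℝ) (lam : ℝ) :
    gibbsExpect J lam (fun φ => if 0 ≤ ∑ x, φ x then (1 : ℝ) else -1) = 0 := by
  unfold gibbsExpect
  rw [integral_signM_mul_gibbsWeight, zero_div]

/-- **Each magnetisation sector carries half the target mass**: `∫_{M ≥ 0} e^{−S} = Z/2` (`λ > 0`). -/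
theorem integral_posSector_mul_gibbsWeight {lam : ℝ} (hlam : 0 < lam)
    (J : Fin (n + 1) → Fin (n + 1) → ℝ) :
    ∫ φ : Fin (n + 1) → ℝ, (if 0 ≤ ∑ x, φ x then (1 : ℝ) else 0) * gibbsWeight J lam φ
      = gibbsZ J lam / 2 := by
  have hw := integrable_gibbsWeight hlam J
  have hmeas : Measurable fun φ : Fin (n + 1) → ℝ => ∑ x, φ x :=
    Finset.measurable_sum _ fun x _ => measurable_pi_apply x
  have hs : Integrable (fun φ : Fin (n + 1) → ℝ =>
      (if 0 ≤ ∑ x, φ x then (1 : ℝ) else 0) * gibbsWeight J lam φ) := by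
    refine Integrable.mono' hw ((Measurable.ite (measurableSet_le measurable_const hmeas)
      measurable_const measurable_const).mul (continuous_gibbsWeight J lam).measurable).aestronglyMeasurable
      (Eventually.of_forall fun φ => ?_)
    have h0 := (gibbsWeight_pos J lam φ).le
    rw [Real.norm_eq_abs, abs_mul, abs_of_nonneg h0]
    split_ifs <;> simp [h0]
  have hsign := integral_signM_mul_gibbsWeight J lam
  -- `sgn = 2·1_{≥0} − 1`
  have e : ∀ φ : Fin (n + 1) → ℝ, (if 0 ≤ ∑ x, φ x then (1 : ℝ) else -1) * gibbsWeight J lam φ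
      = 2 * ((if 0 ≤ ∑ x, φ x then (1 : ℝ) else 0) * gibbsWeight J lam φ) - gibbsWeight J lam φ := by
    intro φ
    split_ifs <;> ring
  simp_rw [e] at hsign
  rw [integral_sub (hs.const_mul 2) hw, integral_const_mul] at hsign
  unfold gibbsZ
  linarith

/-! ## §3 The sandwich for `sgn M`, every model -/
/-- **For EVERY model density, `W₂/Z² − ½ ≤ τ_int(sgn M) ≤ ½ + 12 W₂/Z²`** along the exact φ⁴ flow
sampler (`λ > 0`, any `J`; `q̃ > 0` measurable, `∫ q̃ = 1`, `W₂ = ∫ e^{−2S}/q̃ < ∞`). -/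
theorem phi4Flow_signM_tauInt_sandwich {lam : ℝ} (hlam : 0 < lam)
    (J : Fin (n + 1) → Fin (n + 1) → ℝ) {q : (Fin (n + 1) → ℝ) → ℝ} (hq0 : ∀ φ, 0 < q φ)
    (hqm : Measurable q) (hqi : Integrable q) (hq1 : ∫ φ, q φ = 1)
    (hW₂ : Integrable (fun φ => gibbsWeight J lam φ / q φ * gibbsWeight J lam φ)) :
    (∫ φ, gibbsWeight J lam φ / q φ * gibbsWeight J lam φ) / (∫ φ, gibbsWeight J lam φ) ^ 2 - 1 / 2
      ≤ tauInt (fun k => (∫ φ, ((if 0 ≤ ∑ x, φ x then (1 : ℝ) else -1)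
            - gibbsExpect J lam (fun ψ => if 0 ≤ ∑ x, ψ x then (1 : ℝ) else -1))
          * ((imhOpPhi4 J lam q)^[k] (fun ψ => (if 0 ≤ ∑ x, ψ x then (1 : ℝ) else -1)
            - gibbsExpect J lam (fun ψ => if 0 ≤ ∑ x, ψ x then (1 : ℝ) else -1))) φ
          * gibbsWeight J lam φ)
          / ∫ φ, ((if 0 ≤ ∑ x, φ x then (1 : ℝ) else -1)
            - gibbsExpect J lam (fun ψ => if 0 ≤ ∑ x, ψ x then (1 : ℝ) else -1)) ^ 2
            * gibbsWeight J lam φ)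
    ∧ tauInt (fun k => (∫ φ, ((if 0 ≤ ∑ x, φ x then (1 : ℝ) else -1)
            - gibbsExpect J lam (fun ψ => if 0 ≤ ∑ x, ψ x then (1 : ℝ) else -1))
          * ((imhOpPhi4 J lam q)^[k] (fun ψ => (if 0 ≤ ∑ x, ψ x then (1 : ℝ) else -1)
            - gibbsExpect J lam (fun ψ => if 0 ≤ ∑ x, ψ x then (1 : ℝ) else -1))) φ
          * gibbsWeight J lam φ)
          / ∫ φ, ((if 0 ≤ ∑ x, φ x then (1 : ℝ) else -1)
            - gibbsExpect J lam (fun ψ => if 0 ≤ ∑ x, ψ x then (1 : ℝ) else -1)) ^ 2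
            * gibbsWeight J lam φ)
      ≤ 1 / 2 + 12 * (∫ φ, gibbsWeight J lam φ / q φ * gibbsWeight J lam φ)
          / (∫ φ, gibbsWeight J lam φ) ^ 2 := by
  have hmeas : Measurable fun φ : Fin (n + 1) → ℝ => ∑ x, φ x :=
    Finset.measurable_sum _ fun x _ => measurable_pi_apply x
  have hfm : Measurable (fun φ : Fin (n + 1) → ℝ => if 0 ≤ ∑ x, φ x then (1 : ℝ) else -1) :=
    Measurable.ite (measurableSet_le measurable_const hmeas) measurable_const measurable_const
  have hfb : ∀ φ : Fin (n + 1) → ℝ, |(if 0 ≤ ∑ x, φ x then (1 : ℝ) else -1)| ≤ 1 := fun φ => by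
    split_ifs <;> simp
  have hg1 : ∀ φ : Fin (n + 1) → ℝ, ((if 0 ≤ ∑ x, φ x then (1 : ℝ) else -1)
      - gibbsExpect J lam (fun ψ => if 0 ≤ ∑ x, ψ x then (1 : ℝ) else -1)) ^ 2 = 1 := fun φ => by
    rw [gibbs_signM_mean, sub_zero]
    split_ifs <;> norm_num
  exact phi4Flow_sign_tauInt_sandwich hlam J hq0 hqm hqi hq1 hW₂ hfm hfb hg1

/-! ## §4 The mode-collapse floor: two-sector data processing -/

/-- **Two-sector data processing**: `q̃₊ = ∫_{M≥0} q̃ > 0`, `q̃₋ = ∫_{M<0} q̃ > 0` and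
`W₂ ≥ (Z²/4)(1/q̃₊ + 1/q̃₋)`. -/
theorem weightMoment_ge_sectors {lam : ℝ} (hlam : 0 < lam) (J : Fin (n + 1) → Fin (n + 1) → ℝ)
    {q : (Fin (n + 1) → ℝ) → ℝ} (hq0 : ∀ φ, 0 < q φ) (hqi : Integrable q)
    (hW₂ : Integrable (fun φ => gibbsWeight J lam φ / q φ * gibbsWeight J lam φ)) :
    0 < ∫ φ : Fin (n + 1) → ℝ, (if 0 ≤ ∑ x, φ x then (1 : ℝ) else 0) * q φ
    ∧ 0 < ∫ φ : Fin (n + 1) → ℝ, (if 0 ≤ ∑ x, φ x then (0 : ℝ) else 1) * q φ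
    ∧ (gibbsZ J lam) ^ 2 / 4 * (1 / (∫ φ : Fin (n + 1) → ℝ, (if 0 ≤ ∑ x, φ x then (1 : ℝ) else 0) * q φ)
        + 1 / (∫ φ : Fin (n + 1) → ℝ, (if 0 ≤ ∑ x, φ x then (0 : ℝ) else 1) * q φ))
      ≤ ∫ φ, gibbsWeight J lam φ / q φ * gibbsWeight J lam φ := by
  have hZ := gibbsZ_pos hlam J
  have hw := integrable_gibbsWeight hlam J
  have hmeas : Measurable fun φ : Fin (n + 1) → ℝ => ∑ x, φ x :=
    Finset.measurable_sum _ fun x _ => measurable_pi_apply x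
  have hA : MeasurableSet {φ : Fin (n + 1) → ℝ | 0 ≤ ∑ x, φ x} := measurableSet_le measurable_const hmeas
  set s : (Fin (n + 1) → ℝ) → ℝ := fun φ => if 0 ≤ ∑ x, φ x then (1 : ℝ) else 0 with hs
  set s' : (Fin (n + 1) → ℝ) → ℝ := fun φ => if 0 ≤ ∑ x, φ x then (0 : ℝ) else 1 with hs'
  have hsm : Measurable s := Measurable.ite hA measurable_const measurable_const
  have hs'm : Measurable s' := Measurable.ite hA measurable_const measurable_const
  have hs01 : ∀ φ, 0 ≤ s φ ∧ s φ ≤ 1 := fun φ => by simp only [hs]; split_ifs <;> simp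
  have hs'01 : ∀ φ, 0 ≤ s' φ ∧ s' φ ≤ 1 := fun φ => by simp only [hs']; split_ifs <;> simp
  have hss' : ∀ φ, s φ + s' φ = 1 := fun φ => by simp only [hs, hs']; split_ifs <;> simp
  have cut : ∀ {c F : (Fin (n + 1) → ℝ) → ℝ}, Measurable c → (∀ φ, 0 ≤ c φ ∧ c φ ≤ 1) →
      Integrable F → Integrable (fun φ => c φ * F φ) := by
    intro c F hcm hc hF
    refine Integrable.mono' hF.norm (hcm.aestronglyMeasurable.mul hF.aestronglyMeasurable)
      (Eventually.of_forall fun φ => ?_)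
    rw [norm_mul, Real.norm_eq_abs, abs_of_nonneg (hc φ).1]
    exact mul_le_of_le_one_left (norm_nonneg _) (hc φ).2
  have key : ∀ {c : (Fin (n + 1) → ℝ) → ℝ}, Measurable c → (∀ φ, 0 ≤ c φ ∧ c φ ≤ 1) →
      (∫ φ, c φ * gibbsWeight J lam φ) ^ 2
        ≤ (∫ φ, c φ * q φ) * ∫ φ, c φ * (gibbsWeight J lam φ / q φ * gibbsWeight J lam φ) := by
    intro c hcm hc
    have h := sq_integral_le_integral_mul (μ := volume) (m := fun φ => c φ * q φ)
      (g := fun φ => gibbsWeight J lam φ / q φ)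
      (fun φ => mul_nonneg (hc φ).1 (hq0 φ).le) (cut hcm hc hqi)
      ((cut hcm hc hw).congr (Eventually.of_forall fun φ => by
        show c φ * gibbsWeight J lam φ = c φ * q φ * (gibbsWeight J lam φ / q φ)
        have hq := (hq0 φ).ne'
        field_simp))
      ((cut hcm hc hW₂).congr (Eventually.of_forall fun φ => by
        show c φ * (gibbsWeight J lam φ / q φ * gibbsWeight J lam φ)
          = c φ * q φ * (gibbsWeight J lam φ / q φ) ^ 2
        have hq := (hq0 φ).ne'
        field_simp))
    have e1 : ∫ φ, c φ * q φ * (gibbsWeight J lam φ / q φ) = ∫ φ, c φ * gibbsWeight J lam φ :=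
      integral_congr_ae (Eventually.of_forall fun φ => by
        show c φ * q φ * (gibbsWeight J lam φ / q φ) = c φ * gibbsWeight J lam φ
        have hq := (hq0 φ).ne'
        field_simp)
    have e2 : ∫ φ, c φ * q φ * (gibbsWeight J lam φ / q φ) ^ 2
        = ∫ φ, c φ * (gibbsWeight J lam φ / q φ * gibbsWeight J lam φ) :=
      integral_congr_ae (Eventually.of_forall fun φ => by
        show c φ * q φ * (gibbsWeight J lam φ / q φ) ^ 2
          = c φ * (gibbsWeight J lam φ / q φ * gibbsWeight J lam φ)
        have hq := (hq0 φ).ne'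
        field_simp)
    rw [e1, e2] at h
    exact h
  have hpos := integral_posSector_mul_gibbsWeight hlam J
  have hneg : ∫ φ, s' φ * gibbsWeight J lam φ = gibbsZ J lam / 2 := by
    have e : ∀ φ, s' φ * gibbsWeight J lam φ = gibbsWeight J lam φ - s φ * gibbsWeight J lam φ :=
      fun φ => by
        have h := hss' φ
        have : s' φ = 1 - s φ := by linarith
        rw [this]; ring
    simp_rw [e]
    rw [integral_sub hw (cut hsm hs01 hw), hpos]
    unfold gibbsZ
    ring
  have k1 := key hsm hs01
  have k2 := key hs'm hs'01
  rw [hpos] at k1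
  rw [hneg] at k2
  have hqP0 : 0 ≤ ∫ φ, s φ * q φ := integral_nonneg fun φ => mul_nonneg (hs01 φ).1 (hq0 φ).le
  have hqN0 : 0 ≤ ∫ φ, s' φ * q φ := integral_nonneg fun φ => mul_nonneg (hs'01 φ).1 (hq0 φ).le
  have hZ2 : 0 < (gibbsZ J lam / 2) ^ 2 := by positivity
  have hqP : 0 < ∫ φ, s φ * q φ := by
    rcases hqP0.lt_or_eq with h | h
    · exact h
    · rw [← h, zero_mul] at k1; linarith
  have hqN : 0 < ∫ φ, s' φ * q φ := by
    rcases hqN0.lt_or_eq with h | h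
    · exact h
    · rw [← h, zero_mul] at k2; linarith
  refine ⟨hqP, hqN, ?_⟩
  have hsum : (∫ φ, s φ * (gibbsWeight J lam φ / q φ * gibbsWeight J lam φ))
      + ∫ φ, s' φ * (gibbsWeight J lam φ / q φ * gibbsWeight J lam φ)
      = ∫ φ, gibbsWeight J lam φ / q φ * gibbsWeight J lam φ := by
    rw [← integral_add (cut hsm hs01 hW₂) (cut hs'm hs'01 hW₂)]
    refine integral_congr_ae (Eventually.of_forall fun φ => ?_)
    show s φ * _ + s' φ * _ = _
    rw [← add_mul, hss' φ, one_mul]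
  have h1 : (gibbsZ J lam) ^ 2 / 4 * (1 / ∫ φ, s φ * q φ)
      ≤ ∫ φ, s φ * (gibbsWeight J lam φ / q φ * gibbsWeight J lam φ) := by
    rw [show (gibbsZ J lam) ^ 2 / 4 * (1 / ∫ φ, s φ * q φ)
        = (gibbsZ J lam / 2) ^ 2 / ∫ φ, s φ * q φ by ring, div_le_iff₀ hqP]
    calc (gibbsZ J lam / 2) ^ 2
        ≤ (∫ φ, s φ * q φ) * ∫ φ, s φ * (gibbsWeight J lam φ / q φ * gibbsWeight J lam φ) := k1
      _ = (∫ φ, s φ * (gibbsWeight J lam φ / q φ * gibbsWeight J lam φ)) * ∫ φ, s φ * q φ :=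
          mul_comm _ _
  have h2 : (gibbsZ J lam) ^ 2 / 4 * (1 / ∫ φ, s' φ * q φ)
      ≤ ∫ φ, s' φ * (gibbsWeight J lam φ / q φ * gibbsWeight J lam φ) := by
    rw [show (gibbsZ J lam) ^ 2 / 4 * (1 / ∫ φ, s' φ * q φ)
        = (gibbsZ J lam / 2) ^ 2 / ∫ φ, s' φ * q φ by ring, div_le_iff₀ hqN]
    calc (gibbsZ J lam / 2) ^ 2
        ≤ (∫ φ, s' φ * q φ) * ∫ φ, s' φ * (gibbsWeight J lam φ / q φ * gibbsWeight J lam φ) := k2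
      _ = (∫ φ, s' φ * (gibbsWeight J lam φ / q φ * gibbsWeight J lam φ)) * ∫ φ, s' φ * q φ :=
          mul_comm _ _
  rw [mul_add, ← hsum]
  exact add_le_add h1 h2

/-- **THE MODE-COLLAPSE FLOOR OF THE φ⁴ FLOW ARM.**  For EVERY positive model density `q̃` with
`∫ q̃ = 1` and square-integrable weights, the sign of the magnetisation obeys
`τ_int(sgn M) ≥ ¼(1/q̃(M ≥ 0) + 1/q̃(M < 0)) − ½` along the exact flow sampler (`λ > 0`, any `J`,
every volume): a flow proposing one sector with probability `ε` has `τ_int(sgn M) ≥ 1/(4ε(1−ε)) − ½`. -/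
theorem phi4Flow_signM_tauInt_ge_sectors {lam : ℝ} (hlam : 0 < lam)
    (J : Fin (n + 1) → Fin (n + 1) → ℝ) {q : (Fin (n + 1) → ℝ) → ℝ} (hq0 : ∀ φ, 0 < q φ)
    (hqm : Measurable q) (hqi : Integrable q) (hq1 : ∫ φ, q φ = 1)
    (hW₂ : Integrable (fun φ => gibbsWeight J lam φ / q φ * gibbsWeight J lam φ)) :
    1 / 4 * (1 / (∫ φ : Fin (n + 1) → ℝ, (if 0 ≤ ∑ x, φ x then (1 : ℝ) else 0) * q φ)
        + 1 / (∫ φ : Fin (n + 1) → ℝ, (if 0 ≤ ∑ x, φ x then (0 : ℝ) else 1) * q φ)) - 1 / 2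
      ≤ tauInt (fun k => (∫ φ, ((if 0 ≤ ∑ x, φ x then (1 : ℝ) else -1)
            - gibbsExpect J lam (fun ψ => if 0 ≤ ∑ x, ψ x then (1 : ℝ) else -1))
          * ((imhOpPhi4 J lam q)^[k] (fun ψ => (if 0 ≤ ∑ x, ψ x then (1 : ℝ) else -1)
            - gibbsExpect J lam (fun ψ => if 0 ≤ ∑ x, ψ x then (1 : ℝ) else -1))) φ
          * gibbsWeight J lam φ)
          / ∫ φ, ((if 0 ≤ ∑ x, φ x then (1 : ℝ) else -1)
            - gibbsExpect J lam (fun ψ => if 0 ≤ ∑ x, ψ x then (1 : ℝ) else -1)) ^ 2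
            * gibbsWeight J lam φ) := by
  have hZ := gibbsZ_pos hlam J
  obtain ⟨hlow, -⟩ := phi4Flow_signM_tauInt_sandwich hlam J hq0 hqm hqi hq1 hW₂
  obtain ⟨-, -, hsec⟩ := weightMoment_ge_sectors hlam J hq0 hqi hW₂
  refine le_trans (sub_le_sub_right ?_ _) hlow
  rw [le_div_iff₀ (by positivity)]
  unfold gibbsZ at hsec hZ
  calc 1 / 4 * (1 / (∫ φ : Fin (n + 1) → ℝ, (if 0 ≤ ∑ x, φ x then (1 : ℝ) else 0) * q φ)
        + 1 / (∫ φ : Fin (n + 1) → ℝ, (if 0 ≤ ∑ x, φ x then (0 : ℝ) else 1) * q φ))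
        * (∫ φ, gibbsWeight J lam φ) ^ 2
      = (∫ φ, gibbsWeight J lam φ) ^ 2 / 4
        * (1 / (∫ φ : Fin (n + 1) → ℝ, (if 0 ≤ ∑ x, φ x then (1 : ℝ) else 0) * q φ)
          + 1 / (∫ φ : Fin (n + 1) → ℝ, (if 0 ≤ ∑ x, φ x then (0 : ℝ) else 1) * q φ)) := by ring
    _ ≤ ∫ φ, gibbsWeight J lam φ / q φ * gibbsWeight J lam φ := hsec

end Lattice

end Summit.Ventures.LatticeQCDFlow.Exactness
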